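import Mathlib
import Summits.PneNP.PneNP.Theses.LatticeMagic
import Literature.Computability.MetaComplexity.XorPseudoexpectation
import Literature.Computability.MetaComplexity.SOSThreeColouringProofs
import Summits.PneNP.PneNP.Theorems.LatticeMagicBooleanSosBlindAtConstantFactorDefs
import Summits.PneNP.PneNP.Theorems.LatticeMagicBooleanSosBlindAtConstantFactorStubFooled
import Summits.PneNP.PneNP.Theorems.LatticeMagicBooleanSosBlindAtConstantFactorStubNo
import Summits.PneNP.PneNP.Theorems.LatticeMagicBooleanSosBlindAtConstantFactorStubParity
import Summits.PneNP.PneNP.Theorems.LatticeMagicBooleanSosBlindAtConstantFactorStubEncode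

/-!
# PneNP / LatticeMagic — crux `BooleanSosBlindAtConstantFactor` (stmt-PneNP-2330): the closing file

`Summit.PneNP.PneNP.Theses.LatticeMagic.BooleanSosBlindAtConstantFactor` — "degree-`n^δ` Boolean SOS
does not refute the bit-encoded closeness system of some constant-factor `GapCVP` NO-instances of
polynomial bit-size" — PROVED along the line `Sketch` (Construction-A road; registered skeleton
`Cruxes/BooleanSosBlindAtConstantFactor/Lines/Sketch.lean`): with `γ₀ = 1`, `δ = 1/2`, `C = 3`,
`m = 2`, the instances are the Construction-A lattices `conAInstance (K²) (6K²) C K` of the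
unsatisfiable cover-expanding 3-CNFs of `ThreeColGadget.exists_unsat_coverExpander` (read as 3-XOR
systems), and the fooled pseudoexpectation is the pushforward of the tree's PROVED Grigoriev–Schoenebeck
parity functional (`XorDerivation.lean` / `XorPseudoexpectation.lean`). The four registered stubs are
LANDED theorems of the sibling files (`…StubFooled.lean` — the pushforward; `…StubNo.lean` — the
NO-instance geometry; `…StubParity.lean` — CNF-unsat ⇒ parity-unsat; `…StubEncode.lean` — bit-size),
the vocabulary is `…Defs.lean`; this file is the sorry-free composition, the deciding theorem `booleanSosBlindAtConstantFactor_proof`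
(the body of the registered skeleton's `BooleanSosBlindAtConstantFactor_of` fed with the four stubs). Sources: Grigoriev 2001 (TCS 259) §2; Schoenebeck 2008
Thm. 4.1/§5; Kothari–Mori–O'Donnell–Witmer 2017 Def. 2.7–2.8; Chvátal–Szemerédi 1988 (unsatisfiable
expanding formulas); Conway–Sloane Construction A / Micciancio–Goldwasser 2002 Ch. 1.
-/

set_option linter.dupNamespace false -- `Summit.PneNP.PneNP.…`: summit = sub-problem (D-0017)

namespace Summit.PneNP.PneNP.Theorems.ConA

open scoped BigOperators
open Literature.Algebra.EuclideanLattices Literature.Computability.Complexity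
  Literature.Computability.MetaComplexity

noncomputable section

/-! ## The deciding theorem -/

/-- **`BooleanSosBlindAtConstantFactor` holds** (route `LatticeMagic`, crux stmt-PneNP-2330): for
`γ₀ = 1`, `δ = 1/2`, `C = 3` and every `n₀` there is a NO-instance `p = conAInstance (K²) (6K²) C K`
of `GapCVP_1` of dimension `n = 7K² ≥ n₀` and bit-size `≤ n³`, with bit budget `m = 2 ≤ n³`, whose
closeness system is satisfied by a degree-`⌈n^{1/2}⌉` Boolean pseudoexpectation — the composition of
the four landed stubs `stub_fooled`, `stub_no`, `stub_parity`, `stub_encode` with the unsatisfiable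
cover-expanding 3-CNFs of `ThreeColGadget.exists_unsat_coverExpander`. -/
theorem booleanSosBlindAtConstantFactor_proof :
    Summit.PneNP.PneNP.Theses.LatticeMagic.BooleanSosBlindAtConstantFactor := by
  have h_fooled : ∀ {N me : ℕ} (C : Fin me → Clause ℕ), (∀ e, C e ∈ kClauses 3 N) →
      ∀ {r c : ℝ} {Dx D : ℕ}, VecExpands (fun e => clauseVec (C e)) r c → 0 < c → 2 ≤ r →
      (Dx : ℝ) ≤ c * r / 2 → 3 * D + 3 ≤ Dx → ∀ d₀ : ℚ, ⌊(d₀ : ℝ) ^ 2⌋ = N →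
      Fooled D (conAInstance N me C d₀) 2 := stub_fooled
  have h_no : ∀ {N me : ℕ} (C : Fin me → Clause ℕ), XorUnsat N me C → ∀ d₀ : ℚ, 0 < d₀ →
      (d₀ : ℝ) ^ 2 < N + 1 → conAInstance N me C d₀ ∈ GapCVP.no (fun _ => (1 : ℝ)) := stub_no
  have h_parity : ∀ {N me : ℕ} (C : Fin me → Clause ℕ), (∀ e, C e ∈ kClauses 3 N) →
      ¬ CNF.Satisfiable (List.ofFn C) → XorUnsat N me C := stub_parity
  have h_encode : ∃ c : ℕ, ∀ (N me : ℕ) (C : Fin me → Clause ℕ) (K : ℕ),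
      (GapCVPInstance.encode (conAInstance N me C (K : ℚ))).length ≤
        c * ((N + me + 1) ^ 2 + Nat.log 2 K + 1) := stub_encode
  classical
  rw [crux_iff]
  obtain ⟨κ, hκ, -, N₀, hgood⟩ := ThreeColGadget.exists_unsat_coverExpander
  obtain ⟨cE, hcE⟩ := h_encode
  refine ⟨1, le_rfl, 1 / 2, by norm_num, 3, fun n₀ => ?_⟩
  -- the size parameter `K` (dimension `n = 7 K²`)
  obtain ⟨K, hK⟩ : ∃ K : ℕ, N₀ + n₀ + ⌈(62 : ℝ) / κ⌉₊ + cE + 10 ≤ K := ⟨_, le_rfl⟩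
  have hK10 : 10 ≤ K := by omega
  have hKN₀ : N₀ ≤ K := by omega
  have hKn₀ : n₀ ≤ K := by omega
  have hKcE : cE ≤ K := by omega
  have hK62 : ⌈(62 : ℝ) / κ⌉₊ ≤ K := by omega
  have hKpos : 0 < K := by omega
  have hKr : (10 : ℝ) ≤ K := by exact_mod_cast hK10
  have hκK : (62 : ℝ) ≤ κ * K := by
    have h1 : (62 : ℝ) / κ ≤ K := (Nat.le_ceil _).trans (by exact_mod_cast hK62)
    rwa [div_le_iff₀ hκ, mul_comm] at h1
  obtain ⟨N, hN⟩ : ∃ N : ℕ, N = K ^ 2 := ⟨_, rfl⟩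
  have hNK : K ≤ N := by rw [hN]; nlinarith
  have hN₀ : N₀ ≤ N := hKN₀.trans hNK
  have hNr : (N : ℝ) = (K : ℝ) ^ 2 := by rw [hN]; push_cast; ring
  -- the unsatisfiable expanding 3-CNF on `N` variables with `6 N` clauses
  obtain ⟨f, hunsat, hcov⟩ := hgood N hN₀
  obtain ⟨C, hCf⟩ : ∃ C : Fin (6 * N) → Clause ℕ, C = fun e => (f e : Clause ℕ) := ⟨_, rfl⟩
  have hC : ∀ e, C e ∈ kClauses 3 N := fun e => by rw [hCf]; exact (f e).2
  have hunsat' : ¬ CNF.Satisfiable (List.ofFn C) := by rw [hCf]; exact hunsat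
  have hcov' : IsCoverExpander (fun e => clauseScope (C e)) ⌊κ * N⌋₊ (7 / 4) := by
    rw [hCf]; exact hcov
  -- vector expansion of the scope vectors
  have hsc : ∀ e, (clauseScope (C e)).card ≤ 3 := fun e =>
    (card_clauseScope_le _).trans (length_of_mem_kClauses (hC e)).le
  have hbd : IsBoundaryExpander (fun e => clauseScope (C e)) ⌊κ * N⌋₊ (1 / 2) := by
    refine IsCoverExpander.isBoundaryExpander (k := 3) hsc ?_
    norm_num
    exact hcov'
  have hvec : VecExpands (fun e => clauseVec (C e)) ⌊κ * N⌋₊ (1 / 2) := by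
    have h : (fun e => clauseVec (C e)) = fun e => indVec (clauseScope (C e)) :=
      funext fun e => clauseVec_eq_indVec (nodup_map_fst_of_mem_kClauses (hC e))
    rw [h]
    exact vecExpands_of_isBoundaryExpander hbd
  -- degrees
  have hn7 : N + 6 * N = 7 * K ^ 2 := by rw [hN]; ring
  obtain ⟨D, hD⟩ : ∃ D : ℕ, D = ⌈((N + 6 * N : ℕ) : ℝ) ^ (1 / 2 : ℝ)⌉₊ := ⟨_, rfl⟩
  have hD3K : D ≤ 3 * K := by
    rw [hD, Nat.ceil_le, hn7, ← Real.sqrt_eq_rpow]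
    push_cast
    rw [Real.sqrt_le_left (by positivity)]
    nlinarith
  have hfloor : κ * N - 1 < (⌊κ * N⌋₊ : ℕ) := Nat.sub_one_lt_floor _
  have hκN : (62 : ℝ) * K ≤ κ * N := by rw [hNr]; nlinarith
  have hr2 : (2 : ℝ) ≤ (⌊κ * N⌋₊ : ℕ) := by nlinarith
  have hDx : (((3 * D + 3 : ℕ)) : ℝ) ≤ 1 / 2 * (⌊κ * N⌋₊ : ℕ) / 2 := by
    have h1 : (D : ℝ) ≤ 3 * K := by exact_mod_cast hD3K
    push_cast
    nlinarith
  -- the four stubs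
  have hX : XorUnsat N (6 * N) C := h_parity C hC hunsat'
  have hd0 : (0 : ℚ) < (K : ℚ) := by exact_mod_cast hKpos
  have hKQ : (((K : ℚ)) : ℝ) = (K : ℝ) := by push_cast; ring
  have hdN : (((K : ℚ)) : ℝ) ^ 2 < N + 1 := by rw [hKQ, ← hNr]; linarith
  have hfl : ⌊(((K : ℚ)) : ℝ) ^ 2⌋ = (N : ℤ) := by
    have : (((K : ℚ)) : ℝ) ^ 2 = ((N : ℤ) : ℝ) := by rw [hKQ, Int.cast_natCast, hNr]
    rw [this, Int.floor_intCast]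
  have hno : conAInstance N (6 * N) C (K : ℚ) ∈ GapCVP.no (fun _ => (1 : ℝ)) := h_no C hX _ hd0 hdN
  obtain ⟨E, hE, hB, hQ⟩ :=
    h_fooled C hC hvec (by norm_num) hr2 hDx (le_refl (3 * D + 3)) (K : ℚ) hfl
  -- sizes
  have hpow : 66 * K ^ 5 ≤ (7 * K ^ 2) ^ 3 := by
    have h5 : (7 * K ^ 2) ^ 3 = 343 * K ^ 6 := by ring
    have h6 : K ^ 6 = K ^ 5 * K := by ring
    rw [h5, h6]
    nlinarith [Nat.zero_le (K ^ 5)]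
  have hlen : (GapCVPInstance.encode (conAInstance N (6 * N) C (K : ℚ))).length ≤ (N + 6 * N) ^ 3 := by
    refine (hcE N (6 * N) C K).trans ?_
    rw [hn7]
    refine le_trans ?_ hpow
    have hlog : Nat.log 2 K ≤ K := Nat.log_le_self 2 K
    have hK2 : 1 ≤ K ^ 2 := Nat.one_le_pow _ _ hKpos
    have h1 : (7 * K ^ 2 + 1) ^ 2 ≤ 64 * K ^ 4 := by
      have : 7 * K ^ 2 + 1 ≤ 8 * K ^ 2 := by omega
      calc (7 * K ^ 2 + 1) ^ 2 ≤ (8 * K ^ 2) ^ 2 := Nat.pow_le_pow_left this 2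
        _ = 64 * K ^ 4 := by ring
    have hK4 : K ≤ K ^ 4 := by
      calc K = K ^ 1 := (pow_one K).symm
        _ ≤ K ^ 4 := Nat.pow_le_pow_right hKpos (by norm_num)
    have h14 : 1 ≤ K ^ 4 := Nat.one_le_pow _ _ hKpos
    have h3 : (7 * K ^ 2 + 1) ^ 2 + Nat.log 2 K + 1 ≤ 66 * K ^ 4 := by omega
    calc cE * ((7 * K ^ 2 + 1) ^ 2 + Nat.log 2 K + 1) ≤ K * (66 * K ^ 4) := Nat.mul_le_mul hKcE h3
      _ = 66 * K ^ 5 := by ring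
      _ ≤ 66 * K ^ 5 := le_rfl
  have hm : 2 ≤ (N + 6 * N) ^ 3 := by
    rw [hn7]
    refine le_trans ?_ hpow
    have : 1 ≤ K ^ 5 := Nat.one_le_pow _ _ hKpos
    omega
  have hn₀ : n₀ ≤ N + 6 * N := by omega
  refine ⟨conAInstance N (6 * N) C (K : ℚ), 2, hn₀, hno, hlen, hm, ?_⟩
  show Fooled ⌈((N + 6 * N : ℕ) : ℝ) ^ (1 / 2 : ℝ)⌉₊ (conAInstance N (6 * N) C (K : ℚ)) 2
  rw [← hD]
  exact ⟨E, hE, hB, hQ⟩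

end

end Summit.PneNP.PneNP.Theorems.ConA
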